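import Summits.HubbardSuperconductivity.HubbardSuperconductivity.Theorems.AnisotropyChordTransferFibre3FinGradCell

/-!
# Route `AnisotropyChord` / H0 rotor rung: FIN regime certificate at `L = 9` — kernel facts, part d

KERNEL FACTS (zero data): cells of the λ-cover of the a-priori window at `L = 9` pass the sharpened regime check
`FinCell.mholeCellOK2 9 a b` (`…Fibre3FinGradCell`: layer-0/1 positivity, then either the cell is vacuous — the anisotropy
enclosure lies below `0` — or `‖Π⁰‖² > 0` and `hi(T⁺) ≤ lo(ε₁(1 − 5/V + 6/V²)/2)`, with `T⁺ = 3λ + Σ Π⁰·C0 / ‖Π⁰‖²` evaluated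
in position space over the `V² = 6561` configurations), one `decide +kernel` each (≈ 3 min per non-vacuous cell; `maxHeartbeats
400000` pre-budgeted).  The cell list (15 points, units of `D = 2^60`; designed with the prover's float mirror `scratch/fin_iv2.py`)
is assembled in `…Fibre3FinMHoleNine` into `mholeCheck2 9 cells9 = true` and, by `…FinMHoleSound.mHole_nonneg_of_cells`, into
`0 ≤ mHole 9 Δ f` for every ground profile, every `0 < Δ < 1`.
Prover seat `hubbard-h0-rotor-p3` g4; helper for stmt-HubbardSuperconductivity-23918 (piece A of rung 19089; `--supports`, helper class).
WHAT THIS IS NOT: nothing here proves superconductivity in the Hubbard model (rotor TARGET as worded stays FALSE, g15 verdict); kernel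
facts for ONE hypothesis (regime clause) of ONE conditional reduction at one `L`. Tree imports only; no sorry, no `native_decide`.
-/

set_option linter.dupNamespace false
set_option autoImplicit false

namespace Summit.HubbardSuperconductivity.HubbardSuperconductivity.Theorems.AnisotropyChord.Transfer.Fibre3

namespace FinCell

set_option maxHeartbeats 400000 in
/-- kernel fact: cell 7 of 14 at `L = 9`, `λ·2^60 ∈ [24521787241074228, 27414847760229324]`, passes the regime check. [folklore] -/
theorem cell9_7 : mholeCellOK2 9 24521787241074228 27414847760229324 = true := by
  decide +kernel

set_option maxHeartbeats 400000 in
/-- kernel fact: cell 8 of 14 at `L = 9`, `λ·2^60 ∈ [27414847760229324, 32043723838290400]`, passes the regime check. [folklore] -/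
theorem cell9_8 : mholeCellOK2 9 27414847760229324 32043723838290400 = true := by
  decide +kernel

end FinCell

end Summit.HubbardSuperconductivity.HubbardSuperconductivity.Theorems.AnisotropyChord.Transfer.Fibre3
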